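import Summits.BirchSwinnertonDyer.BirchSwinnertonDyer.Theorems.ThetaPartnerAtTwoSignedControlAtTwoSignedLocalInjEngine
import Summits.BirchSwinnertonDyer.BirchSwinnertonDyer.Theorems.ByReductionTypeAtTwoSupersingularTowerTorsionTwo
import Literature.NumberTheory.EllipticCurves.Kobayashi2003.SignedSelmerGeneratorChangeProofs
import HarnessLib

/-!
# INJ⁺@2 (registered stub `stub_plusLocalInjTwo` of K4 `SignedControlAtTwo`, stmt-BirchSwinnertonDyer-20309, line
# `eulerchar` v4) ⟸ ONE local statement: the `Γ_{ℚ₂}`-invariant classes of `(⋃ₙ E⁺(ℚ_{2,n})) ⊗ ℚ₂/ℤ₂` come from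
# `E(ℚ₂) ⊗ ℚ₂/ℤ₂` — the plumbing from Kobayashi's `Sel^ε(E/K_∞)` to the engine of `…SignedLocalInjEngine`

Route `ThetaPartnerAtTwo` (TP2; crux shared with RTT), crux K4, line `eulerchar` v4 (lead `prover-bsd-wall-tp2-p3`);
seat `prover-bsd-wall-tp2-p3-w3` (width seat 3/3). Sequel of `…SignedControlAtTwoSignedLocalInjEngine`
(«`r_v^ε` injective» on the classes Kummer-from-`A` ⟸ (NT) no `p`-torsion in `E(K_∞·K_v)` + (LIFT_A)).

WHAT.
* §1 (any number field `K`, prime `p`, `ℤ_p`-extension `κ`, sign `ε`, place `v ∋ p`)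
  `signedSelmerInfty_le_localKummerOverOfEmb_iSup_signedLocalPoints` — Kobayashi's `Sel^ε(E/K_∞) = ⋃ₙ hₙ(Sel^ε(E/K_n))`
  lies in the Kummer condition at the chosen place `𝔭 ∣ v` of `K_∞` cut out by `A^ε := ⨆ₙ E^ε(K_n·K_v)`: each
  `c ∈ Sel^ε(E/K_n)` is Kummer-from-`E^ε(K_n·K_v)` at `𝔭` (its `σ = 1` conjugate), restriction `hₙ` preserves Kummer
  classes (`Kobayashi2003.resOfLe_mem_localKummerOverOfEmb`), and `E^ε(K_n·K_v) ≤ A^ε`.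
* §2 (same generality) `localResOver_eq_zero_of_mem_comap_signedSelmerInfty_of_invariantsLift` — **«`r_v^ε` is
  injective» for Kobayashi's signed Selmer group**: under (NT) and (LIFT) for `A^ε`, every `y ∈ H¹(K, E[p^∞])` with
  `h_0 y ∈ Sel^ε(E/K_∞)` is classically Selmer at `v` (`loc_v y = 0` in `H¹(K_v, E)`). B. D. Kim 2013, proof of
  Cor. 3.15: «If `v ∣ p`, `g_v` is injective because `E(F_v) ⊗ ℚ_p/ℤ_p = (∏_{w∣v} H^±_w)^Γ`» — here the displayed
  equality is the HYPOTHESIS (LIFT), elementwise, and the injectivity is DERIVED in the kernel.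
* §3 (`K = ℚ`, `p = 2`, `ε = 1`) `plusLocalInj_two_of_invariantsLift` — at a good supersingular `2` the torsion
  hypothesis (NT) is the tree theorem `SSFlatEC.eq_zero_of_mem_localTowerPointsOfEmb_of_two_nsmul` (Sprung 2012
  Lemma 2.3 at `2`), so: **the body of the registered stub `stub_plusLocalInjTwo` (for one `W`, one `κ`, one `v ∋ 2`)
  follows from (LIFT⁺@2) alone** — for every `x ∈ ⋃ₙ E⁺(ℚ_{2,n}·)` and `k`, if `σx − x ∈ 2^k·E(ℚ_{2,∞})` for all
  `σ ∈ Γ_{ℚ₂}` then `x ∈ 2^k·E(ℚ_{2,∞}) + E(ℚ₂)`; and `stub_plusLocalInjTwo_of_invariantsLift` — the registered stub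
  VERBATIM (its habitat prefix `¬CM, r_an = 0, a₂ = 0` unused) from (LIFT⁺@2) quantified over the sub-row.

WHY. This isolates the research residue of INJ⁺@2 (the `±` local theory at `2`, not in print: Kobayashi 2003 §8 /
Kim 2007 Prop. 4.28 are odd-`p`; Kurihara–Otsuki 2006 p. 557 assert the method carries over) as ONE elementwise
statement about ONE `Γ_{ℚ₂}`-module `E(ℚ_{2,∞})` with its filtration by Kobayashi's trace-defined `E⁺(ℚ_{2,n})` — in
print it is the consequence `(E⁺_∞ ⊗ ℚ_p/ℤ_p)^Γ = E(ℚ_p) ⊗ ℚ_p/ℤ_p` of Kobayashi's Thm. 6.2 / Prop. 8.12 structure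
`(E^±(k_∞) ⊗ ℚ_p/ℤ_p)^∨ ≅ Λ`-type results (odd `p`).

HONEST FRAMING: THEOREMS ONLY (no definition, no named fact, no `sorry`), route-independent (no `Theses` import);
nothing about any curve is asserted beyond the displayed hypotheses; closes no item (the stub stays open: (LIFT⁺@2)
is its research content); BSD is not proved by any of this.

References: [BDKim2013] B. D. Kim, J. Aust. Math. Soc. 95 (2013), proof of Cor. 3.15 (p. 199); [Kobayashi2003]
S. Kobayashi, Invent. Math. 152 (2003), Def. 1.1, Thm. 6.2, Props. 8.12, 8.23, Thm. 9.3; [Sprung2024] F. Sprung,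
Adv. Math. 449 (2024), §5.2 proof of Lemma 5.5; [Sprung2012] F. Sprung, J. Number Theory 132 (2012), Lemma 2.3;
[KuriharaOtsuki2006] p. 557.
-/

set_option autoImplicit false
-- the Theorems namespace of this sub repeats the summit name by design (D-0017 nested layout)
set_option linter.dupNamespace false

noncomputable section

open scoped Classical NumberField

open NumberField IsDedekindDomain

universe u

namespace Summit.BirchSwinnertonDyer.BirchSwinnertonDyer.Theorems.SignedEC

open Literature.NumberTheory.EllipticCurves Literature.NumberTheory.GaloisRepresentations
  WeierstrassCurve ZpExtension Literature.NumberTheory.EllipticCurves.Kobayashi2003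
  Literature.NumberTheory.EllipticCurves.Sprung2012

/-! ## §1 `Sel^ε(E/K_∞)` lies in the Kummer condition cut out by `⨆ₙ E^ε(K_n·K_v)` at `𝔭` -/

section General

variable {K : Type u} [Field K] [NumberField K] (W : WeierstrassCurve K) {p : ℕ} [Fact p.Prime]
  (κ : ZpExtension K p) (ε : ℤˣ)

omit [NumberField K] in
/-- `⨆ₙ E^ε(K_n·K_v) ≤ E(K_∞·K_v)`: each `E^ε(K_n·K_v) ≤ E(K_n·K_v) ≤ E(K_∞·K_v)`.
[cite: Kobayashi2003, Def. 1.1 (p. 2)] -/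
theorem iSup_signedLocalPointsOfEmb_le_localTowerPointsOfEmb {E : Type u} [Field E] [Algebra K E]
    (ι : AlgebraicClosure K →ₐ[K] AlgebraicClosure E) :
    (⨆ n, signedLocalPointsOfEmb κ ι W ε n) ≤ localTowerPointsOfEmb κ ι W :=
  iSup_le fun n ↦ (signedLocalPointsOfEmb_le κ ι W ε n).trans
    (localLayerPointsOfEmb_le_localTowerPointsOfEmb κ ι W n)

/-- **`Sel^ε(E/K_∞)` is Kummer-from-`⨆ₙ E^ε(K_n·K_v)` at the chosen place above `v ∋ p`.** For every
`s ∈ Sel^ε(E/K_∞) = ⨆ₙ hₙ(Sel^ε(E/K_n))` (Kobayashi Def. 1.1, `signedSelmerInfty`), `s` lies in the Kummer condition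
`localKummerOverOfEmb W p (ker κ) closureEmb (⨆ₙ E^ε(K_n·K_v))`: a generator `hₙ c`, `c ∈ Sel^ε(E/K_n)`, is
Kummer-from-`E^ε(K_n·K_v)` over `K_n` at `𝔭` (the `σ = 1` conjugate of its signed condition), restriction to `K_∞`
preserves this (`resOfLe_mem_localKummerOverOfEmb`), and the condition is monotone in the subgroup; the condition
is an additive subgroup, so the `⨆` follows. [cite: Kobayashi2003, Def. 1.1 (p. 2) and §2 p. 4] -/
theorem signedSelmerInfty_le_localKummerOverOfEmb_iSup_signedLocalPoints
    (v : HeightOneSpectrum (𝓞 K)) (hv : (p : 𝓞 K) ∈ v.asIdeal) :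
    signedSelmerInfty W κ ε ≤
      localKummerOverOfEmb W p κ.kerSubgroup (closureEmb (K := K) (v.adicCompletion K))
        (⨆ n, signedLocalPoints κ (v.adicCompletion K) W ε n) := by
  refine iSup_le fun n ↦ ?_
  rintro s ⟨c, hc, rfl⟩
  have hc' := ((mem_signedSelmerLayer_iff W κ ε n c).mp hc).2 v hv 1
  rw [W.conjH1_one_holds p (κ.layerSubgroup n), AddMonoidHom.id_apply] at hc'
  have h2 := resOfLe_mem_localKummerOverOfEmb W p (closureEmb (K := K) (v.adicCompletion K))
    (κ.kerSubgroup_le_layerSubgroup n) _ hc'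
  exact localKummerOverOfEmb_mono
    (le_iSup (fun m ↦ signedLocalPoints κ (v.adicCompletion K) W ε m) n) h2

/-- Hence every `y ∈ A^ε_0 = h_0⁻¹(Sel^ε(E/K_∞))` has `h_0 y` Kummer-from-`⨆ₙ E^ε(K_n·K_v)` at `𝔭`.
[cite: Kobayashi2003, Def. 1.1 (p. 2)] -/
theorem layerToInfty_mem_localKummerOverOfEmb_iSup_of_mem_comap_signedSelmerInfty
    (v : HeightOneSpectrum (𝓞 K)) (hv : (p : 𝓞 K) ∈ v.asIdeal)
    {y : W.subgroupH1 p (κ.layerSubgroup 0)} (hy : y ∈ (signedSelmerInfty W κ ε).comap (W.layerToInfty κ 0)) :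
    W.layerToInfty κ 0 y ∈
      localKummerOverOfEmb W p κ.kerSubgroup (closureEmb (K := K) (v.adicCompletion K))
        (⨆ n, signedLocalPoints κ (v.adicCompletion K) W ε n) :=
  signedSelmerInfty_le_localKummerOverOfEmb_iSup_signedLocalPoints W κ ε v hv (AddSubgroup.mem_comap.mp hy)

/-! ## §2 «`r_v^ε` is injective» for Kobayashi's `Sel^ε(E/K_∞)` ⟸ (NT) + (LIFT) -/

/-- **«`r_v^ε` is injective» (B. D. Kim 2013, proof of Cor. 3.15; Kobayashi 2003 Thm. 9.3's local input) for
Kobayashi's signed Selmer group, from (NT) + (LIFT).** Let `v ∋ p`, `M = E(K_∞·K_v)` at the chosen place `𝔭`,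
`A^ε = ⨆ₙ E^ε(K_n·K_v) ≤ M`. ASSUME (NT) `M` has no `p`-torsion and (LIFT) for every `x ∈ A^ε` and `k`, if
`σx − x ∈ p^k M` for all `σ ∈ Γ_{K_v}` then `x − p^k R ∈ E(K_v)` for some `R ∈ M` (= «`E(K_v) ⊗ ℚ_p/ℤ_p` exhausts the
`Γ_{K_v}`-invariant classes of `A^ε ⊗ ℚ_p/ℤ_p`»). THEN every `y ∈ H¹(K, E[p^∞])` with `h_0 y ∈ Sel^ε(E/K_∞)` satisfies
the classical local condition at `v`: `loc_v y = 0` in `H¹(K_v, E)`. (§1 + the engine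
`localResOver_eq_zero_of_layerToInfty_mem_localKummerOver_of_invariantsLift`.)
[cite: BDKim2013, proof of Cor. 3.15 (p. 199)] [cite: Kobayashi2003, Thm. 9.3 (p. 26)]
[cite: Sprung2024, §5.2 proof of Lemma 5.5, case v = p (p. 40)] -/
theorem localResOver_eq_zero_of_mem_comap_signedSelmerInfty_of_invariantsLift
    (v : HeightOneSpectrum (𝓞 K)) (hv : (p : 𝓞 K) ∈ v.asIdeal)
    (hnt : ∀ P ∈ localTowerPointsOfEmb κ (closureEmb (K := K) (v.adicCompletion K)) W, p • P = 0 → P = 0)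
    (hlift : ∀ x ∈ (⨆ n, signedLocalPoints κ (v.adicCompletion K) W ε n), ∀ k : ℕ,
      (∀ σ : Field.absoluteGaloisGroup (v.adicCompletion K),
        ∃ w ∈ localTowerPointsOfEmb κ (closureEmb (K := K) (v.adicCompletion K)) W, σ • x - x = p ^ k • w) →
      ∃ R ∈ localTowerPointsOfEmb κ (closureEmb (K := K) (v.adicCompletion K)) W,
        x - p ^ k • R ∈ localLayerPointsOfEmb κ (closureEmb (K := K) (v.adicCompletion K)) W 0)
    {y : W.subgroupH1 p (κ.layerSubgroup 0)} (hy : y ∈ (signedSelmerInfty W κ ε).comap (W.layerToInfty κ 0)) :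
    W.localResOver p (κ.layerSubgroup 0) (v.adicCompletion K) y = 0 :=
  localResOver_eq_zero_of_layerToInfty_mem_localKummerOver_of_invariantsLift W κ (v.adicCompletion K)
    (⨆ n, signedLocalPoints κ (v.adicCompletion K) W ε n)
    (iSup_signedLocalPointsOfEmb_le_localTowerPointsOfEmb W κ ε (closureEmb (K := K) (v.adicCompletion K)))
    hnt hlift
    (layerToInfty_mem_localKummerOverOfEmb_iSup_of_mem_comap_signedSelmerInfty W κ ε v hv hy)

end General

/-! ## §3 `K = ℚ`, `p = 2`, `ε = 1`: INJ⁺@2 ⟸ (LIFT⁺@2) alone -/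

section Two

variable (W : WeierstrassCurve ℚ) [W.IsElliptic] [W.IsGloballyMinimal]

/-- **INJ⁺@2 for one curve, one `ℤ₂`-extension and the place above `2`, from (LIFT⁺@2) alone.** At a good
supersingular `2`, `E(ℚ_∞·ℚ₂)` has no `2`-torsion (tree theorem
`SSFlatEC.eq_zero_of_mem_localTowerPointsOfEmb_of_two_nsmul`, Sprung 2012 Lemma 2.3 at `2`), so (NT) is discharged:
if every `Γ_{ℚ₂}`-invariant class of `(⨆ₙ E⁺(ℚ_{2,n})) ⊗ ℚ₂/ℤ₂` inside `E(ℚ_{2,∞}) ⊗ ℚ₂/ℤ₂` comes from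
`E(ℚ₂) ⊗ ℚ₂/ℤ₂` (elementwise: `x ∈ ⨆ₙ E⁺(ℚ_{2,n})`, `σx − x ∈ 2^k E(ℚ_{2,∞})` for all `σ` ⇒ `x ∈ 2^k E(ℚ_{2,∞}) + E(ℚ₂)`),
then every `y ∈ H¹(ℚ, E[2^∞])` with `h_0 y ∈ Sel⁺(E/ℚ_∞)` is classically Selmer at `2`.
[cite: BDKim2013, proof of Cor. 3.15 (p. 199)] [cite: Kobayashi2003, Thm. 9.3 (p. 26)]
[cite: Sprung2012, Lemma 2.3 (p. 1487)] -/
theorem plusLocalInj_two_of_invariantsLift (hss : Rank1Residual.GoodSS W 2) (κ : ZpExtension ℚ 2)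
    (v : HeightOneSpectrum (𝓞 ℚ)) (hv : (2 : 𝓞 ℚ) ∈ v.asIdeal)
    (hlift : ∀ x ∈ (⨆ n, signedLocalPoints κ (v.adicCompletion ℚ) W 1 n), ∀ k : ℕ,
      (∀ σ : Field.absoluteGaloisGroup (v.adicCompletion ℚ),
        ∃ w ∈ localTowerPointsOfEmb κ (closureEmb (K := ℚ) (v.adicCompletion ℚ)) W, σ • x - x = 2 ^ k • w) →
      ∃ R ∈ localTowerPointsOfEmb κ (closureEmb (K := ℚ) (v.adicCompletion ℚ)) W,
        x - 2 ^ k • R ∈ localLayerPointsOfEmb κ (closureEmb (K := ℚ) (v.adicCompletion ℚ)) W 0) :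
    ∀ y ∈ (signedSelmerInfty W κ 1).comap (W.layerToInfty κ 0),
      W.localResOver 2 (κ.layerSubgroup 0) (v.adicCompletion ℚ) y = 0 := by
  intro y hy
  have hnt : ∀ P ∈ localTowerPointsOfEmb κ (closureEmb (K := ℚ) (v.adicCompletion ℚ)) W, 2 • P = 0 → P = 0 :=
    fun P hP h2 ↦ SSFlatEC.eq_zero_of_mem_localTowerPointsOfEmb_of_two_nsmul W hss κ (by exact_mod_cast hv) _ hP h2
  exact localResOver_eq_zero_of_mem_comap_signedSelmerInfty_of_invariantsLift W κ 1 v (by exact_mod_cast hv)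
    hnt hlift hy

/-- **The registered stub `stub_plusLocalInjTwo` (INJ⁺@2) of line `eulerchar` v4 ⟸ (LIFT⁺@2) over the sub-row.**
If for every `W/ℚ` on the sub-row `¬CM, r_an = 0, GoodSS 2, a₂ = 0`, every cyclotomic `ℤ₂`-extension `κ`, the place
`v ∋ 2`, every `x ∈ ⨆ₙ E⁺(ℚ_{2,n})` and `k`: `σx − x ∈ 2^k E(ℚ_{2,∞})` for all `σ ∈ Γ_{ℚ₂}` ⇒ `x ∈ 2^k E(ℚ_{2,∞}) + E(ℚ₂)`
— then the stub's statement holds verbatim (only `GoodSS W 2` of the prefix is used, for (NT)).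
[cite: BDKim2013, proof of Cor. 3.15 (p. 199)] [cite: Kobayashi2003, Props. 8.12, 8.23, Thm. 9.3 (odd p)]
[cite: KuriharaOtsuki2006, p. 557] -/
theorem stub_plusLocalInjTwo_of_invariantsLift
    (hLIFT : ∀ (W : WeierstrassCurve ℚ) [W.IsElliptic] [W.IsGloballyMinimal],
      ¬ W.HasCM → W.analyticRank = 0 → Rank1Residual.GoodSS W 2 → W.frobeniusTrace 2 = 0 →
      ∀ (κ : ZpExtension ℚ 2), κ.IsCyclotomic →
      ∀ (v : HeightOneSpectrum (𝓞 ℚ)), (2 : 𝓞 ℚ) ∈ v.asIdeal →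
      ∀ x ∈ (⨆ n, signedLocalPoints κ (v.adicCompletion ℚ) W 1 n), ∀ k : ℕ,
        (∀ σ : Field.absoluteGaloisGroup (v.adicCompletion ℚ),
          ∃ w ∈ localTowerPointsOfEmb κ (closureEmb (K := ℚ) (v.adicCompletion ℚ)) W, σ • x - x = 2 ^ k • w) →
        ∃ R ∈ localTowerPointsOfEmb κ (closureEmb (K := ℚ) (v.adicCompletion ℚ)) W,
          x - 2 ^ k • R ∈ localLayerPointsOfEmb κ (closureEmb (K := ℚ) (v.adicCompletion ℚ)) W 0) :
    ∀ (W : WeierstrassCurve ℚ) [W.IsElliptic] [W.IsGloballyMinimal],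
      ¬ W.HasCM → W.analyticRank = 0 → Rank1Residual.GoodSS W 2 → W.frobeniusTrace 2 = 0 →
      ∀ (κ : ZpExtension ℚ 2), κ.IsCyclotomic →
      ∀ (v : HeightOneSpectrum (𝓞 ℚ)), (2 : 𝓞 ℚ) ∈ v.asIdeal →
      ∀ y ∈ (signedSelmerInfty W κ 1).comap (W.layerToInfty κ 0),
        W.localResOver 2 (κ.layerSubgroup 0) (v.adicCompletion ℚ) y = 0 :=
  fun W _ _ hcm hr hss ha κ hκ v hv ↦
    plusLocalInj_two_of_invariantsLift W hss κ v hv (hLIFT W hcm hr hss ha κ hκ v hv)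

end Two

end Summit.BirchSwinnertonDyer.BirchSwinnertonDyer.Theorems.SignedEC

end
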